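import Mathlib
import HarnessLib
import HarnessLib.Audit
import Summits.HodgeConjecture.Statement
import Literature.AlgebraicGeometry.Tropical.CellularTropicalHomology
import Literature.AlgebraicGeometry.HodgeTheory.SparseFermatFamily
import Literature.AlgebraicGeometry.HodgeTheory.HodgeConjecture
import HarnessLib.Audit.Status.Attr

/-!
Route: SparseFermatTropicalDeficiency

CLOSED (refuted) 2026-08-24T08:40:41Z by gate — reason: refuted:stmt-HodgeConjecture-18620 (InvariantClassesAreHodge) by Summit.HodgeConjecture.HodgeConjecture.Theorems.not_InvariantClassesAreHodge — note: repair grace of 72.0 h (deadline 2026-08-24T08:37:23Z) expired without a repair — closed by the gate. The file is kept as the record of this route; refuted decls are indexed as negative knowledge (`ledger negatives`).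

# Route SparseFermatTropicalDeficiency — sparse Fermat sixfolds — tropical cycle deficiency at
generic heights against Shioda's invariant Hodge classes (refutation side)

REFUTATION route: it suffices to show X = K1 ∧ K2 ∧ K4, and `closes : K1 → K2 → K4 → ¬
HodgeConjecture` is proved logic (glue.lean).
A sparse Fermat datum 𝔇 = (p, d, B) is the family X_c = {Σ x_i^d + Σ_{b∈B} c_b x^b = 0} ⊂ ℙ^{2p+1}
with its diagonal symmetry group
A_B ⊂ μ_d^{2p+2}; Shioda's character calculus gives m(𝔇) = 1 + #(admissible characters in Λ_B)
classes in H^{2p}(X_c)^{A_B}, all of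
Hodge type (p,p) when 𝔇 is PURE. K4 (Shioda side): for a pure datum these m invariant classes are
rational Hodge classes and any
A_B-invariant span containing them has cup-product rank ≥ m. K2 (transfer): at generic unimodular
heights h there is a valued realisation
(c, v) with v(c_b) = e^{-h_b} such that every finite family of classes supported on closed
codimension-p algebraic subsets has tropical
shadows — balanced rational-slope p-cycles inside Trop_v of the supports, adapted to a polyhedral
structure on the tropical hypersurface
X̄_h — whose classes in cellular tropical homology H_{p,p}(X̄_h; ℝ) span at least the invariant cup
rank. K1 (deficiency): for SOME pure
datum and generic unimodular h, the classes of ALL such tropical p-cycles span < m(𝔇). HC would make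
the m invariant classes algebraic,
K2 transports rank m to the tropical side, K1 forbids it. Card realised:
sparse-fermat-tropical-gram-deficiency (spine).
Lean: `TropicalCycleDeficiency ∧ TropicalShadowsCarryRank ∧ InvariantClassesAreHodge`

## Assembly
Pure logic plus one unfolding, proved in glue.lean (`closes`, 0 sorries): from K1 take (𝔇, h); K2
gives (c, v) and the shadow map; K4
gives e. Under HC each e_i is algebraic, i.e. lies in `algebraicClasses = ⨆ closed Z of codim ≥ p,
ker(H^2p(X) → H^2p(X∖Z))`; an
`iSup_induction'` extracts a finite supported family per e_i, the Σ-indexed union is fed to K2, and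
m ≤ cupRank(span πx) ≤ finrank(span of
tropical classes) < m is absurd. The Assembly item below records the same implication as a Prop (the
deciding theorem is `closes`).

Rationale: WHY THIS LINE. Kontsevich's tropical test (Zharkov arXiv:2002.02347; Amini–Piquerez arXiv:2012.13142
§1.1) says: if algebraic cycles tropicalise to
tropical cycles carrying their classes, a failure of the tropical Hodge conjecture on a tropical
limit refutes the classical one; it was
only ever set up for abelian varieties of Weil type, where the certificate map Φ was never
completed. We move it to toric Calabi–Yau
hypersurface degenerations of sparse Fermat families: Shioda's characters (Shioda1979HodgeFermat)
hand us m explicit invariant Hodge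
classes, purity puts them on the row where the Mikhalkin–Zharkov eigenwave / tropical monodromy N
vanishes (arXiv:1302.0252), and
Amini–Piquerez Thm 1.1 shows the tropical side is FULL at rational heights — so the whole bet is the
arithmetic of irrational generic
heights (K1), isolated from an HC-independent valued-field transfer theorem (K2: Kapranov/structure
theorem MaclaganSturmfels2015 §3,
Liu arXiv:1702.00047, IKMZ arXiv:1604.01838) and from routine Hodge theory (K4). Imported areas:
tropical homology (cellular, over ℝ,
typed in Literature.AlgebraicGeometry.Tropical.CellularTropicalHomology), regular unimodular
triangulations, Fermat character sums.
No prior hub route uses toric corners / tropical limits; the negatives index (3 entries: Milnor-K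
symbol lift, Fermat K3 multisets,
E-line transport) is untouched.

RANKED CRUXES. #2 TropicalCycleDeficiency (crux) — K1 — there is a pure sparse Fermat datum 𝔇 and a
generic (1, h_b ℚ-linearly independent), M_S-unimodular height h such that for EVERY finite
polyhedral structure Q on the tropical hypersurface X̄_h ⊂ TP^{2p+1} and every family of Q-adapted
balanced real-weighted p-cycles, the ℝ-span of their classes in cellular tropical homology
H_{p,p}(X̄_h, Q; ℝ) has dimension < m(𝔇) = invariantRank. Intended instance 𝔇₁ = (3, 8, B₁) (octic
sixfolds, m = 9; birth skeleton). [difficulty: XL] (why it might fail: K1 = failure of the tropical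
Hodge conjecture (arXiv:2012.13142 Conj 1.2) for X̄_h on the (p,p) row where N = 0 by purity; AP Thm
1.1 proves it at every RATIONAL height, so the cycle span must drop at irrational h with no
monodromy/eigenwave certificate available.) [arXiv:2012.13142, arXiv:2002.02347,
MikhalkinZharkov2014Eigenwave, AminiPiquerez2020TropicalHC]
#3 TropicalShadowsCarryRank (crux) — K2 — for every datum 𝔇 and generic unimodular height h there
are coefficients c and a rank-one valuation v on ℂ, trivial on ℚ, with v(c_b) = e^{-h_b} and X_c
smooth, such that for every family (Z_a, x_a) of closed subsets of codimension ≥ p and classes x_a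
vanishing off Z_a there is a polyhedral structure Q on X̄_h and Q-adapted tropical p-cycles C_k with
supp C_k ⊆ Trop_v(Z_{f k}) whose classes span, over ℝ, at least cupRank of the span of the invariant
projections π x_a. [difficulty: XL] (why it might fail: needs tropicalisation of algebraic cycles
over a NON-discretely valued ℂ (irrational h: no family over a disc) to land in cellular
H_(p,p)(X̄_h) compatibly with cup product on the π-invariant part, in the orbifold ambient
ℙ^(2p+1)/A_B; Liu/IKMZ comparison is proved over discs/curves only.) [arXiv:1702.00047,
arXiv:1604.01838, MaclaganSturmfels2015, arXiv:2012.13142]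
#4 InvariantClassesAreHodge (crux) — K4 — for a pure datum 𝔇 and any c with X_c smooth of dimension
2p there are m(𝔇) classes e_i ∈ H^{2p}(X_c; ℂ) that are rational, of Hodge type (p,p) and
π-invariant, such that every family x whose invariant projections span a space containing all e_i
has cupRank ≥ m(𝔇) (Shioda: invariants = ⊕ V(α), α ∈ Λ_B admissible, plus h^p; Hodge numbers
constant in the family; cup product perfect on the trivial isotypic part). [difficulty: L] (why it
might fail: routine in print (Shioda 1979 Thm I, equivariant Poincaré duality, constancy of Hodge
numbers) but must be proved against the tree's complexBetti/cupProduct/IsOfHodgeType/eigenProjector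
interfaces; fails if dim range(π) ≠ invariantRank for some smooth member c ≠ 0.)
[Shioda1979HodgeFermat, Shioda1979PJA, book:voisin2002-hodge-theory-complex-algebraic-geometry-i]

TWO-LAYER PLAN. K2 ⇐ K2a (realisation + Kapranov: a ℚ-trivial valuation with prescribed v(c_b), X_c
smooth, Trop_v X_c = X̄_h with a finite structure) →
K2b (cycle level: Trop_v(Z) of a closed codim-p subset is the support of a balanced rational-slope
p-cycle adapted to a refinement —
Bieri–Groves/structure theorem over non-discrete value groups) → K2c (class level: the cycle class
map intertwines cup product on the
π-invariant part with a bilinear form on H_(p,p)(X̄_h; ℝ), so ranks transfer). K1 ⇐ K1a (instance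
gate: 𝔇₁ pure and a generic unimodular
h exists — finite certificate) → K1b (cycles subordinate to the canonical structure of X̄_h span
s_sub < 9 — finite linear algebra) → K1c
(at generic h no non-subordinate p-cycle adds a new class — the arithmetic heart). Nothing here is
filed now.

KILL CRITERIA. Refuting K2 (a supported algebraic class whose tropical shadows cannot carry its
invariant cup rank) closes the route outright
(close --reason refuted:TropicalShadowsCarryRank) and is itself news for tropical geometry. Refuting
K1 for the named instance 𝔇₁ (nine
independent tropical 3-cycle classes at one generic unimodular height, e.g. s_sub ≥ 9) forces a
pivot to another pure datum or closure;
a proof that H_(p,p)-classes with N = 0 are always carried by tropical cycles (Conj 1.2 of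
arXiv:2012.13142 beyond the rationally
triangulable case) refutes K1 outright. A proof of HC for the invariant part of A_B-symmetric
hypersurfaces (e.g. explicit
Shioda–Aoki-type cycles deforming with c) moots the line and turns the instance into a control.
Typing risk (statement audit target): if the cellular predicate `IsStructureOf` admitted NO finite
structure Q of X̄_h at a
generic height (a definition defect, not mathematics), K1's deficiency clause would hold vacuously
while K2 (which must produce such a Q)
became unprovable — the route cannot mis-fire, but a refuter who shows `¬ ∃ Q, IsStructureOf Q
(𝔇.tropicalVariety h)` files both as
misstated (repair: restate K1/K2 over the corrected predicate); dually, a too-small boundary map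
(missing incidence signs) biases K1
false / K2 true, the safe direction.

NOT DECOMPOSED YET. The instance certificate (purity of 𝔇₁ is a finite check over (ℤ/8)^8; S0 = a
regular M_S-unimodular triangulation of the 18-point
configuration, 256 maximal simplices) is a stub of K1's birth skeleton, not an item. The comparison
dim H_(3,3)(X̄_h; ℝ) = 9 (orbifold
IKMZ) is deliberately NOT assumed anywhere: K1 and K2 are stated so that whichever way it fails, one
of them absorbs it. Poincaré duality
/ Gross–Shokrieh pairing on the tropical side is avoided by stating K1/K2 with spans of homology
classes instead of Gram ranks.

CHEAPEST FALSIFIER. (a) S0 for 𝔇₁: enumerate regular triangulations of (S₁ = {8e_i} ∪ B₁, lattice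
M_S) and test unimodularity (TOPCOM/polymake-size job; not
run in this typing seat). (b) s_sub: for one generic h in a unimodular chamber, compute the
dimension of the span in H_(3,3)(X̄_h) of
balanced weightings of the 3-cells of X̄_h itself (sparse linear algebra on the cell complex); s_sub
≥ 9 kills K1 for 𝔇₁. Locally
verified only: m(𝔇₀) = m(𝔇₁) = 9 and purity of 𝔇₀ (8 admissible characters in Λ_B, all with |tα| = 4
for every unit t).

NUMBERS. 𝔇₀ = (3, 8, B₀), B₀ = {x₁x₂x₄x₅⁴x₇, x₁x₂x₃⁴x₄x₇, x₁²x₂²x₄²x₆², x₀²x₁²x₂⁴}: |Λ_B| = 256,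
admissible invariant characters = 8, all Hodge,
m = 9; B₁ = all 10 A_B-invariant non-diagonal degree-8 monomials (same Λ_B, m = 9); [M₀ : M_S] =
8192, normalised volume of 8Δ₇ for
M_S = 256 = number of maximal simplices a unimodular triangulation must have. Tropical HC known:
rationally triangulable smooth projective
tropical varieties (arXiv:2012.13142 Thm 1.1); codimension one integrally (Jell–Rau–Shaw). HC known
near the instance: nothing for
A_B-symmetric octic sixfolds with c ≠ 0 (K_X trivial, h^(6,0) = 1, so decomposition-of-the-diagonal
controls do not apply).

DEFINITION REQUESTS. None outstanding. Landed for this route (T0, cited):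
Literature.AlgebraicGeometry.Tropical.CellularTropicalHomology (p169737: TropPoint,
TropCell, multi-tangent coefficients, cellular chains/boundary, tropHomology, TropCycle,
tropHypersurface, RegularUnimodular) and
Literature.AlgebraicGeometry.HodgeTheory.SparseFermatFamily (SparseFermat.Datum, variety, group,
proj, charLattice, invariantRank, IsPure,
tropicalVariety, IsUnimodularHeight, IsGenericHeight, tropicalization, cupRank;
group_le_diagonalStabilizer proved).

Novelty: Searches (2026-08-17): lit search --hybrid "tropical Hodge conjecture rationally triangulable" (8
docs, all classical Hodge theory books —
corpus held no tropical-HC text; arXiv:2012.13142 and arXiv:2002.02347 fetched and now held); lit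
search (arxiv) "Zharkov tropical Hodge
conjecture abelian Kontsevich" → 1 (arXiv:2002.02347); "Amini Piquerez tropical Hodge conjecture" →
arXiv:2012.13142 + local
paper:arxiv-2009.04690 p.3; "Liu tropical cycle classes non-Archimedean" → arXiv:1702.00047;
"Itenberg Katzarkov Mikhalkin Zharkov
tropical homology" → arXiv:1604.01838, arXiv:2307.02945; lit galaxy search "tropical Hodge
conjecture|eigenwave|tropical homology"
--star all → 20 rows, 0 relevant (physics 'eigenwave'); "tropical Hodge conjecture" --star pdf → 0;
"tropical homology" --star pdf → 0;
panama title~tropical "Hodge conjecture" → 0; ledger negatives --problem HodgeConjecture → 3, none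
related.
Nearest prior art found: arXiv:2002.02347 (Zharkov: Kontsevich's scheme on tropical abelian
fourfolds of Weil type; the certificate Φ
is left unfinished); arXiv:2012.13142 Thm 1.1 / Conj 1.2 (Amini–Piquerez: tropical HC for rationally
triangulable varieties, the
general case flagged open with N real); MikhalkinZharkov2014Eigenwave (arXiv:1302.0252: eigenwave
obstruction); internal 2001 archive
hodge-neg/forced-class-tropical-hypersurface (torus case; its Thm A kills the twisted branch,
leaving the invariant branch used here).
Delta: Kontsevich's test transplanted from abelian varieties  [refs: 2012.13142, 2002.02347, 1702.00047, 1604.01838, 2307.02945, 1302.0252, paper:arxiv-2009.04690]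

Barriers (technique_class: tropical-homology, toric-degeneration, fermat-characters): - technique_class: tropical-homology, toric-degeneration, fermat-characters
- Literature.Barriers.HodgeConjecture.Andre1996_hodgeClassesOnAbelianVarieties_motivated: it does
not evade it in spirit: the π-invariant classes on X_c are motivated (the Fermat motive is of
abelian type by the Shioda–Katsura inductive structure, and motivated classes staying Hodge deform,
André 1996 Thm 0.5), so K1 ∧ K2 would refute Grothendieck's standard conjecture B as well — the bet
is explicit (declared low-prior test route); the barrier theorem itself quantifies over abelian
varieties and does not apply to hypersurfaces.
- Literature.Barriers.HodgeConjecture.Charles2009_conjugateVarieties_cohomologyAlgebrasNotIso (and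
the absolute-Hodge file): outside the class — no Galois-conjugation / absoluteness argument is used;
the witness classes are absolute Hodge and the route never needs them not to be.
- Literature.Barriers.HodgeConjecture.CattaniDeligneKaplan1995_hodgeLocus_algebraicFor: outside —
the invariant classes are Hodge on the whole smooth family (the Hodge locus is everything),
consistent with Cattani–Deligne–Kaplan; no non-algebraic-locus argument.
- Literature.Barriers.HodgeConjecture.BabaeeHuh2017_HCplus_false: outside — Babaee–Huh go tropical ⇒
positive current and refute only HC⁺; this line goes algebraic ⇒ tropical shadow (K2, the sound
Kontsevich–Zharkov direction) and never infers algebraicity or its failure from positivity.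
- Literature.Barriers.HodgeConjecture.BlochSrinivas1983_

History (route lifecycle, newest last):
- 2026-08-21T08:37:23Z · BROKEN — InvariantClassesAreHodge (stmt-HodgeConjecture-18620, crux) refuted by Summit.HodgeConjecture.HodgeConjecture.Theorems.not_InvariantClassesAreHodge @ 470cbfc85063 (prover-pub-hodge-ring2-b04-g30-0)
- 2026-08-24T08:40:46Z · CLOSED refuted — refuted:stmt-HodgeConjecture-18620 (InvariantClassesAreHodge) by Summit.HodgeConjecture.HodgeConjecture.Theorems.not_InvariantClassesAreHodge (grace expired, auto-close) (gate)

sub-problem: HodgeConjecture · status: closed(refuted) · opened planner-type-18fd2f43ef-0 2026-08-17T16:48:35Z · rev 0 · ledger route-HodgeConjecture-SparseFermatTropicalDeficiency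
GENERATED by the gate from the ledger (D-0016/17). Provers cite these decls: `theorem foo : Summit.HodgeConjecture.HodgeConjecture.Theses.SparseFermatTropicalDeficiency.<Decl> := …` in Summits/HodgeConjecture/HodgeConjecture/Theorems/<Name>.lean.
-/

namespace Summit.HodgeConjecture.HodgeConjecture.Theses.SparseFermatTropicalDeficiency

open scoped BigOperators Topology Manifold Classical MeasureTheory ProbabilityTheory Matrix InnerProductSpace ComplexConjugate ContinuousMap
open Filter Set Function TopologicalSpace MeasureTheory

attribute [summit_statement] _root_.HodgeConjecture

/-- item stmt-HodgeConjecture-18618 · crux · rank 2 · closed · moot by None · by planner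
why it might fail: K1 = failure of the tropical Hodge conjecture (arXiv:2012.13142 Conj 1.2) for X̄_h on the (p,p) row where N = 0 by purity; AP Thm 1.1 proves it at every RATIONAL height, so the cycle span must drop at irrational h with no monodromy/eigenwave certificate available.
sources: arXiv:2012.13142, arXiv:2002.02347, MikhalkinZharkov2014Eigenwave, AminiPiquerez2020TropicalHC
[crux] K1 — there is a pure sparse Fermat datum 𝔇 and a generic (1, h_b ℚ-linearly independent),
M_S-unimodular height h such that for EVERY finite polyhedral structure Q on the tropical
hypersurface X̄_h ⊂ TP^{2p+1} and every family of Q-adapted balanced real-weighted p-cycles, the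
ℝ-span of their classes in cellular tropical homology H_{p,p}(X̄_h, Q; ℝ) has dimension < m(𝔇) =
invariantRank. Intended instance 𝔇₁ = (3, 8, B₁) (octic sixfolds, m = 9; birth skeleton).
[difficulty: XL] -/
@[route_item "route-HodgeConjecture-SparseFermatTropicalDeficiency", crux]
def TropicalCycleDeficiency : Prop :=
  ∃ 𝔇 : Literature.AlgebraicGeometry.HodgeTheory.SparseFermat.Datum, 𝔇.IsPure ∧ ∃ h : ↥𝔇.B → ℝ, 𝔇.IsGenericHeight h ∧ 𝔇.IsUnimodularHeight h ∧ ∀ Q : Finset (Literature.AlgebraicGeometry.Tropical.TropCell (2 * 𝔇.p + 2)), Literature.AlgebraicGeometry.Tropical.IsStructureOf Q (𝔇.tropicalVariety h) → ∀ (κ : Type) (C : κ → Literature.AlgebraicGeometry.Tropical.TropCycle Q 𝔇.p), Module.finrank ℝ ↥(Submodule.span ℝ (Set.range fun k ↦ (C k).cls)) < 𝔇.invariantRank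

/-- item stmt-HodgeConjecture-18619 · crux · rank 3 · closed · moot by None · by planner
why it might fail: needs tropicalisation of algebraic cycles over a NON-discretely valued ℂ (irrational h: no family over a disc) to land in cellular H_(p,p)(X̄_h) compatibly with cup product on the π-invariant part, in the orbifold ambient ℙ^(2p+1)/A_B; Liu/IKMZ comparison is proved over discs/curves only.
sources: arXiv:1702.00047, arXiv:1604.01838, MaclaganSturmfels2015, arXiv:2012.13142
[crux] K2 — for every datum 𝔇 and generic unimodular height h there are coefficients c and a
rank-one valuation v on ℂ, trivial on ℚ, with v(c_b) = e^{-h_b} and X_c smooth, such that for every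
family (Z_a, x_a) of closed subsets of codimension ≥ p and classes x_a vanishing off Z_a there is a
polyhedral structure Q on X̄_h and Q-adapted tropical p-cycles C_k with supp C_k ⊆ Trop_v(Z_{f k})
whose classes span, over ℝ, at least cupRank of the span of the invariant projections π x_a.
[difficulty: XL] -/
@[route_item "route-HodgeConjecture-SparseFermatTropicalDeficiency", crux]
def TropicalShadowsCarryRank : Prop :=
  ∀ (𝔇 : Literature.AlgebraicGeometry.HodgeTheory.SparseFermat.Datum) (h : ↥𝔇.B → ℝ), 𝔇.IsGenericHeight h → 𝔇.IsUnimodularHeight h → ∃ (c : ↥𝔇.B → ℂ) (v : Valuation ℂ NNReal), Literature.AlgebraicGeometry.Motives.IsSmoothProjective (2 * 𝔇.p) (𝔇.variety c) ∧ (∀ q : ℚ, q ≠ 0 → v (q : ℂ) = 1) ∧ (∀ b, ((v (c b) : NNReal) : ℝ) = Real.exp (-h b)) ∧ ∀ (ι : Type) (Z : ι → Set ↥(𝔇.variety c).left) (x : ι → Literature.AlgebraicGeometry.HodgeTheory.complexBetti (𝔇.variety c) (2 * 𝔇.p)), (∀ a, IsClosed (Z a) ∧ ∀ z ∈ Z a,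 ((𝔇.p : ℕ) : ℕ∞) ≤ Order.coheight z) → (∀ a, x a ∈ LinearMap.ker (Literature.AlgebraicGeometry.HodgeTheory.complexBetti.restrictCompl (𝔇.variety c) (Z a) (2 * 𝔇.p)).hom) → ∃ Q : Finset (Literature.AlgebraicGeometry.Tropical.TropCell (2 * 𝔇.p + 2)), Literature.AlgebraicGeometry.Tropical.IsStructureOf Q (𝔇.tropicalVariety h) ∧ ∃ (κ : Type) (f : κ → ι) (C : κ → Literature.AlgebraicGeometry.Tropical.TropCycle Q 𝔇.p), (∀ k, (C k).support ⊆ 𝔇.tropicalization c v (Z (f k))) ∧ Literature.AlgebraicGeometry.HodgeTheory.cupRank (𝔇.variety c) (2 * 𝔇.p) (Submodule.span ℂ (Set.range fun a ↦ 𝔇.proj c (x a))) ≤ Module.finrank ℝ ↥(Submodule.span ℝ (Set.range fun k ↦ (C k).cls))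

/-- item stmt-HodgeConjecture-18620 · crux · rank 4 · closed · refuted by Summit.HodgeConjecture.HodgeConjecture.Theorems.not_InvariantClassesAreHodge @ 470cbfc85063 (prover) · by planner
why it might fail: routine in print (Shioda 1979 Thm I, equivariant Poincaré duality, constancy of Hodge numbers) but must be proved against the tree's complexBetti/cupProduct/IsOfHodgeType/eigenProjector interfaces; fails if dim range(π) ≠ invariantRank for some smooth member c ≠ 0.
sources: Shioda1979HodgeFermat, Shioda1979PJA, book:voisin2002-hodge-theory-complex-algebraic-geometry-i
[crux] K4 — for a pure datum 𝔇 and any c with X_c smooth of dimension 2p there are m(𝔇) classes e_i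
∈ H^{2p}(X_c; ℂ) that are rational, of Hodge type (p,p) and π-invariant, such that every family x
whose invariant projections span a space containing all e_i has cupRank ≥ m(𝔇) (Shioda: invariants =
⊕ V(α), α ∈ Λ_B admissible, plus h^p; Hodge numbers constant in the family; cup product perfect on
the trivial isotypic part). [difficulty: L] -/
@[route_item "route-HodgeConjecture-SparseFermatTropicalDeficiency", crux]
def InvariantClassesAreHodge : Prop :=
  ∀ 𝔇 : Literature.AlgebraicGeometry.HodgeTheory.SparseFermat.Datum, 𝔇.IsPure → ∀ c : ↥𝔇.B → ℂ, Literature.AlgebraicGeometry.Motives.IsSmoothProjective (2 * 𝔇.p) (𝔇.variety c) → ∃ e : Fin 𝔇.invariantRank → Literature.AlgebraicGeometry.HodgeTheory.complexBetti (𝔇.variety c) (2 * 𝔇.p), (∀ i, Literature.AlgebraicGeometry.HodgeTheory.IsRationalClass (e i) ∧ Literature.AlgebraicGeometry.HodgeTheory.IsOfHodgeType (2 * 𝔇.p) (𝔇.variety c) (2 * 𝔇.p) 𝔇.p 𝔇.p (e i) ∧ 𝔇.proj c (e i) = e i) ∧ ∀ (ι : Type) (x : ι → Literature.AlgebraicGeometry.HodgeTheory.complexBetti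 (𝔇.variety c) (2 * 𝔇.p)), (∀ i, e i ∈ Submodule.span ℂ (Set.range fun a ↦ 𝔇.proj c (x a))) → 𝔇.invariantRank ≤ Literature.AlgebraicGeometry.HodgeTheory.cupRank (𝔇.variety c) (2 * 𝔇.p) (Submodule.span ℂ (Set.range fun a ↦ 𝔇.proj c (x a)))

/-- item stmt-HodgeConjecture-18621 · assembly · rank 1 · closed · proved by Summit.HodgeConjecture.HodgeConjecture.Theorems.sparseFermatTropicalDeficiency_assembly_proof @ efb256da1873 (prover) · by planner
sources: arXiv:2002.02347, Shioda1979HodgeFermat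
[assembly] K1 → K2 → K4 → ¬ HodgeConjecture (proved as `closes` in glue.lean; as an item it is
provable-now by the same term). -/
@[route_item "route-HodgeConjecture-SparseFermatTropicalDeficiency"]
def Assembly : Prop :=
  TropicalCycleDeficiency → TropicalShadowsCarryRank → InvariantClassesAreHodge → ¬ _root_.HodgeConjecture

/-! D-0027 §2.1 — DECIDING THEOREM (planner-authored via `route open/edit --closes-file`; by planner-type-18fd2f43ef-0 2026-08-17T16:48:35Z) — ARCHIVED: route closed (refuted) 2026-08-24T08:40:41Z; kept so importers keep building:
its hypotheses are this route's items and its conclusion the sub-problem Statement (glue_lint), and it elaborates with this file. -/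

@[closes "route-HodgeConjecture-SparseFermatTropicalDeficiency"] theorem closes (h1 : TropicalCycleDeficiency) (h2 : TropicalShadowsCarryRank)
    (h4 : InvariantClassesAreHodge) : ¬ _root_.HodgeConjecture := by
  -- the Assembly item K1 → K2 → K4 → ¬HC, proved here and applied (keeps `Assembly` in the cone of `closes`)
  have hA : Assembly := by
    intro h1 h2 h4 hHC
    obtain ⟨𝔇, hpure, h, hgen, huni, hdef⟩ := h1
    obtain ⟨c, v, hX, hvQ, hvc, hshadow⟩ := h2 𝔇 h hgen huni
    obtain ⟨e, he, hrank⟩ := h4 𝔇 hpure c hX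
    have halg : ∀ i, e i ∈ Literature.AlgebraicGeometry.HodgeTheory.algebraicClasses (𝔇.variety c) 𝔇.p :=
      fun i ↦ (hHC hX).2 𝔇.p (e i) (he i).1 (he i).2.1
    -- finite supported decompositions of algebraic classes (unfolding `supportedClasses`)
    have extract : ∀ y ∈ Literature.AlgebraicGeometry.HodgeTheory.algebraicClasses (𝔇.variety c) 𝔇.p,
        ∃ (ι : Type) (Z : ι → Set ↥(𝔇.variety c).left)
          (x : ι → Literature.AlgebraicGeometry.HodgeTheory.complexBetti (𝔇.variety c) (2 * 𝔇.p)),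
          (∀ a, IsClosed (Z a) ∧ ∀ z ∈ Z a, ((𝔇.p : ℕ) : ℕ∞) ≤ Order.coheight z) ∧
          (∀ a, x a ∈ LinearMap.ker
            (Literature.AlgebraicGeometry.HodgeTheory.complexBetti.restrictCompl (𝔇.variety c) (Z a) (2 * 𝔇.p)).hom) ∧
          y ∈ Submodule.span ℂ (Set.range x) := by
      intro y hy
      have zero_case : ∃ (ι : Type) (Z : ι → Set ↥(𝔇.variety c).left)
          (x : ι → Literature.AlgebraicGeometry.HodgeTheory.complexBetti (𝔇.variety c) (2 * 𝔇.p)),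
          (∀ a, IsClosed (Z a) ∧ ∀ z ∈ Z a, ((𝔇.p : ℕ) : ℕ∞) ≤ Order.coheight z) ∧
          (∀ a, x a ∈ LinearMap.ker
            (Literature.AlgebraicGeometry.HodgeTheory.complexBetti.restrictCompl (𝔇.variety c) (Z a) (2 * 𝔇.p)).hom) ∧
          (0 : Literature.AlgebraicGeometry.HodgeTheory.complexBetti (𝔇.variety c) (2 * 𝔇.p)) ∈
            Submodule.span ℂ (Set.range x) :=
        ⟨Empty, fun a ↦ a.elim, fun a ↦ a.elim, fun a ↦ a.elim, fun a ↦ a.elim,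
          Submodule.zero_mem _⟩
      simp only [Literature.AlgebraicGeometry.HodgeTheory.algebraicClasses,
        Literature.AlgebraicGeometry.HodgeTheory.supportedClasses] at hy
      induction hy using Submodule.iSup_induction' with
      | mem Z y hy =>
        by_cases hZ : IsClosed Z
        · rw [iSup_pos hZ] at hy
          by_cases hr : ∀ z ∈ Z, ((𝔇.p : ℕ) : ℕ∞) ≤ Order.coheight z
          · rw [iSup_pos hr] at hy
            exact ⟨Unit, fun _ ↦ Z, fun _ ↦ y, fun _ ↦ ⟨hZ, hr⟩, fun _ ↦ hy,
              Submodule.subset_span ⟨(), rfl⟩⟩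
          · rw [iSup_neg hr, Submodule.mem_bot] at hy
            rw [hy]; exact zero_case
        · rw [iSup_neg hZ, Submodule.mem_bot] at hy
          rw [hy]; exact zero_case
      | zero => exact zero_case
      | add y y' _ _ ih ih' =>
        obtain ⟨ι, Z, x, hZ, hx, hy⟩ := ih
        obtain ⟨ι', Z', x', hZ', hx', hy'⟩ := ih'
        refine ⟨ι ⊕ ι', Sum.elim Z Z', Sum.elim x x', ?_, ?_, ?_⟩
        · rintro (a | a)
          · exact hZ a
          · exact hZ' a
        · rintro (a | a)
          · exact hx a
          · exact hx' a
        · rw [Set.Sum.elim_range, Submodule.span_union]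
          exact Submodule.add_mem_sup hy hy'
    choose ιf Zf xf hZf hxf hef using fun i ↦ extract (e i) (halg i)
    obtain ⟨Q, hQ, κ, f, C, -, hle⟩ :=
      hshadow (Σ i, ιf i) (fun s ↦ Zf s.1 s.2) (fun s ↦ xf s.1 s.2) (fun s ↦ hZf s.1 s.2)
        (fun s ↦ hxf s.1 s.2)
    have hm : 𝔇.invariantRank ≤ Literature.AlgebraicGeometry.HodgeTheory.cupRank (𝔇.variety c) (2 * 𝔇.p)
        (Submodule.span ℂ (Set.range fun s : (Σ i, ιf i) ↦ 𝔇.proj c (xf s.1 s.2))) := by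
      refine hrank (Σ i, ιf i) (fun s ↦ xf s.1 s.2) fun i ↦ ?_
      rw [← (he i).2.2]
      have hmap := Submodule.mem_map_of_mem (f := 𝔇.proj c) (hef i)
      rw [Submodule.map_span, ← Set.range_comp] at hmap
      refine Submodule.span_mono ?_ hmap
      rintro _ ⟨a, rfl⟩
      exact ⟨⟨i, a⟩, rfl⟩
    exact lt_irrefl _ ((hm.trans hle).trans_lt (hdef Q hQ κ C))
  exact hA h1 h2 h4

end Summit.HodgeConjecture.HodgeConjecture.Theses.SparseFermatTropicalDeficiency
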